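import Summits.AtomisticToContinuum.Crystallization.Theorems.FrustratedLawDichotomyCellFrame
import Summits.AtomisticToContinuum.Crystallization.Theorems.FrustratedLawDichotomyCertFloorTailsEnergy
import Summits.AtomisticToContinuum.Crystallization.Theorems.FrustratedLawDichotomyWindowSymmetry

/-!
# FrustratedLawDichotomy · crux `AperiodicFrustratedLawGap` (stmt-AtomisticToContinuum-27623) — CELL-SOUND II: COLUMN TRUNCATIONS (NASH, HOST FORCE)
(cell decomp-a2c, lens-5 g113; continues `…CellFrame`; label-frame editions of (hand-1) `…CertFloorTails*` T1–T5)

Role.  Every infinite-looking column of `certFloorL` is split into a NEAR part over label LISTS chosen by the K-file and a FAR part bounded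
by the tree's closed-form shell sums ((226) `shellSum_le_general`, via (hand-1) `sum_psiTail_le` / `sum_linTail_le` / `sum_remTail_le` /
`sum_shellTail_le`).  Label lists, not metric filters: over a strain box the metric near set `{dist < L}` is placement-dependent; a list
need only CONTAIN it (`x ∉ nb z ⇒ L ≤ dist`), a decidable label/window fact.
1. Literal tail constants `S4 … S12`, `psiTail = T0_δ`, `linTail = TL_δ`, `remTail`, `debTail`, `A9 A15 B9 B15`; `certCoeffNearL`.
2. Transport of separation / far-ness to placed sub-templates; the four shell-sum wrappers `sum_*Tail_le_L`.
3. ★ (c) `nashL_le_near_add_tails` — NASH column: near sites `MN`, near bonds `nb`; far sites by `T0_δ(R_N)`, far bonds by `2(Σ‖Y‖)TL_δ(L_N)`.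
4. ★ (d) `hostForceL_le_near_add_tail` — host-force pairing of an interior site: near list + `‖Y_m‖·T0_δ(L_m)`;
   `sum_ljBondForce_eq_zero_of_mirror` — a mirror-closed near list carries zero net force (odd pairing, (hand-1) `…WindowSymmetry`).
Debits, force remainder and the TRUNCATED MASTER are in `…CellTailsRem`.

House conventions: SI units · italic scalars, bold vectors, sans-serif tensors · numbered formulae only when referenced · en-dash for
ranges · References = cited works, numbered, alphabetical · no footnotes; Remarks at section ends · British spelling, -ise · Lennard-Jones
hyphenated; NASH capitalised as the Statement's notion · "folklore" tags standard bookkeeping; no new references are cited in this file.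
-/

noncomputable section

namespace Summit.AtomisticToContinuum.Crystallization.Theorems.FrustratedLawDichotomyCellTails

open MeasureTheory Metric Set RealInnerProductSpace
open scoped BigOperators
open Literature.MathematicalPhysics.StatisticalMechanics (lennardJones rootEnergy)
open Literature.Probability.Process (IsRootedHardCore)
open Summit.AtomisticToContinuum.Crystallization.Theorems.ChargedEnergyGapNegative (E3)
open Summit.AtomisticToContinuum.Crystallization.Theorems.FrustratedLawDichotomyCoherentSets (coherentAt)
open Summit.AtomisticToContinuum.Crystallization.Theorems.FrustratedLawDichotomyCoherentFloorAlgebra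
open Summit.AtomisticToContinuum.Crystallization.Theorems.FrustratedLawDichotomyCoherentFloor
open Summit.AtomisticToContinuum.Crystallization.Theorems.FrustratedLawDichotomyCertFloorTails
open Summit.AtomisticToContinuum.Crystallization.Theorems.FrustratedLawDichotomyCertFloorTailsRem
open Summit.AtomisticToContinuum.Crystallization.Theorems.FrustratedLawDichotomyCertFloorTailsEnergy
open Summit.AtomisticToContinuum.Crystallization.Theorems.FrustratedLawDichotomyWindowSymmetry (sum_ljForce_eq_zero_of_neg_mem)
open Summit.AtomisticToContinuum.Crystallization.Theorems.FrustratedLawDichotomyCellFrame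

variable {ι : Type*} [DecidableEq ι]

/-! ## §4. ★ The NASH-column truncation in the label frame (near lists chosen by the K-file; far parts by the tree's shell sums) -/

/-- FarFieldSharp's shell sums `S_k(δ,R) = (3/k)(2/δ)³R⁻ᵏ + (6(k+2)/(k+1))(2/δ)²R⁻ᵏ⁻¹ + (3/(k+2))(2/δ)R⁻ᵏ⁻² + 2R⁻ᵏ⁻³` at the six orders the
tails use, with LITERAL coefficients (so that `unfold` reproduces the tree statements verbatim). -/
def S4 (δ R : ℝ) : ℝ := 3 / 4 * (2 / δ) ^ 3 * R⁻¹ ^ 4 + 36 / 5 * (2 / δ) ^ 2 * R⁻¹ ^ 5 + 1 / 2 * (2 / δ) * R⁻¹ ^ 6 + 2 * R⁻¹ ^ 7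
/-- `S₅`. -/
def S5 (δ R : ℝ) : ℝ := 3 / 5 * (2 / δ) ^ 3 * R⁻¹ ^ 5 + 7 * (2 / δ) ^ 2 * R⁻¹ ^ 6 + 3 / 7 * (2 / δ) * R⁻¹ ^ 7 + 2 * R⁻¹ ^ 8
/-- `S₆`. -/
def S6 (δ R : ℝ) : ℝ := 1 / 2 * (2 / δ) ^ 3 * R⁻¹ ^ 6 + 48 / 7 * (2 / δ) ^ 2 * R⁻¹ ^ 7 + 3 / 8 * (2 / δ) * R⁻¹ ^ 8 + 2 * R⁻¹ ^ 9
/-- `S₁₀`. -/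
def S10 (δ R : ℝ) : ℝ := 3 / 10 * (2 / δ) ^ 3 * R⁻¹ ^ 10 + 72 / 11 * (2 / δ) ^ 2 * R⁻¹ ^ 11 + 1 / 4 * (2 / δ) * R⁻¹ ^ 12 + 2 * R⁻¹ ^ 13
/-- `S₁₁`. -/
def S11 (δ R : ℝ) : ℝ := 3 / 11 * (2 / δ) ^ 3 * R⁻¹ ^ 11 + 13 / 2 * (2 / δ) ^ 2 * R⁻¹ ^ 12 + 3 / 13 * (2 / δ) * R⁻¹ ^ 13 + 2 * R⁻¹ ^ 14
/-- `S₁₂`. -/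
def S12 (δ R : ℝ) : ℝ := 1 / 4 * (2 / δ) ^ 3 * R⁻¹ ^ 12 + 84 / 13 * (2 / δ) ^ 2 * R⁻¹ ^ 13 + 3 / 14 * (2 / δ) * R⁻¹ ^ 14 + 2 * R⁻¹ ^ 15

/-- `T0_δ(R) = S₄ + S₁₀`: the far first-variation / bond-force column ((hand-1) `sum_psiTail_le`; `= farCol R` at `δ = 7/10`). -/
def psiTail (δ R : ℝ) : ℝ := S4 δ R + S10 δ R

/-- `TL_δ(L) = 9S₅ + 15S₁₁`: the far linearised-force column ((hand-1) `sum_linTail_le`). -/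
def linTail (δ L : ℝ) : ℝ := 9 * S5 δ L + 15 * S11 δ L

/-- `A₉(q)`, `A₁₅(q)` (`q = η/L`): the coefficients of (hand-1) `forceRem_le_far`. -/
def A9 (q : ℝ) : ℝ := 10 * (1 - q)⁻¹ ^ 12 * (2 + q) ^ 2 * (1 + q) + 4 * (3 + q)
/-- `A₁₅(q)`. -/
def A15 (q : ℝ) : ℝ := 28 * (1 - q)⁻¹ ^ 18 * (2 + q) ^ 2 * (1 + q) + 7 * (3 + q)
/-- `B₉(q)`, `B₁₅(q)` (`q = η/L`): the coefficients of (hand-1) `energyRem_le_far`. -/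
def B9 (q : ℝ) : ℝ := 5 / 3 * (1 - q)⁻¹ ^ 12 * (2 + q) ^ 3 + 2 * (2 + q)
/-- `B₁₅(q)`. -/
def B15 (q : ℝ) : ℝ := 14 / 3 * (1 - q)⁻¹ ^ 18 * (2 + q) ^ 3 + 7 / 2 * (2 + q)

/-- The remainder-column tail per unit `Σ‖Y‖`: `(2τ)²·(A₉(2τ/L)·S₆(δ,L) + A₁₅(2τ/L)·S₁₂(δ,L))` ((hand-1) `remColumn_le_near_add_tail`). -/
def remTail (δ L τ : ℝ) : ℝ := (2 * τ) ^ 2 * (A9 (2 * τ / L) * S6 δ L + A15 (2 * τ / L) * S12 δ L)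

/-- The root-bond debit tail: `τ²(7/2·S₅ + 1/2·S₁₁) + τ³(B₉(τ/L)S₆ + B₁₅(τ/L)S₁₂)` ((hand-1) `energyDebit_le_near_add_tail`). -/
def debTail (δ L τ : ℝ) : ℝ := τ ^ 2 * (7 / 2 * S5 δ L + 1 / 2 * S11 δ L) + τ ^ 3 * (B9 (τ / L) * S6 δ L + B15 (τ / L) * S12 δ L)

/-- The NEAR adjoint coefficient in the label frame: both sums of `certCoeffL` restricted to the K-file's near list `nb m` of the site `m`. -/
def certCoeffNearL (M MI : Finset ι) (pos Y : ι → E3) (nb : ι → Finset ι) (m : ι) : E3 :=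
  (if m ∈ MI then ∑ m' ∈ (M.erase m).filter (fun m' => m' ∈ nb m), ljBondForceLin (pos m - pos m') (Y m) else 0)
    - ∑ x ∈ (MI.erase m).filter (fun x => x ∈ nb m), ljBondForceLin (pos x - pos m) (Y x)

section Trunc

variable {M MI : Finset ι} {pos Y : ι → E3}

omit [DecidableEq ι] in
/-- Separation transports to the placed sub-template. [folklore] -/
theorem sep_image {S : Finset ι} {δ : ℝ} (hsep : ∀ a ∈ S, ∀ b ∈ S, a ≠ b → δ ≤ dist (pos a) (pos b)) :
    ∀ u ∈ S.image pos, ∀ v ∈ S.image pos, u ≠ v → δ ≤ dist u v := by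
  intro u hu v hv huv
  obtain ⟨a, ha, rfl⟩ := Finset.mem_image.1 hu
  obtain ⟨b, hb, rfl⟩ := Finset.mem_image.1 hv
  exact hsep a ha b hb fun h => huv (by rw [h])

omit [DecidableEq ι] in
/-- Farness transports to the placed sub-template. [folklore] -/
theorem far_image {S : Finset ι} {p : E3} {R : ℝ} (hfar : ∀ a ∈ S, R ≤ dist (pos a) p) : ∀ u ∈ S.image pos, R ≤ dist u p := by
  intro u hu
  obtain ⟨a, ha, rfl⟩ := Finset.mem_image.1 hu
  exact hfar a ha

omit [DecidableEq ι] in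
/-- Label-frame shell sum, orders `(8, 14)` (linearised force; also the `secondNeg` debit). [folklore] -/
theorem sum_shellTail_le_L (hinj : Set.InjOn pos ↑M) {S : Finset ι} (hS : S ⊆ M) (p : E3) {δ R A B : ℝ} (hδ : 0 < δ) (hR : δ / 2 ≤ R)
    (hA : 0 ≤ A) (hB : 0 ≤ B) (hsep : ∀ a ∈ S, ∀ b ∈ S, a ≠ b → δ ≤ dist (pos a) (pos b)) (hfar : ∀ a ∈ S, R ≤ dist (pos a) p) :
    ∑ a ∈ S, (A * (dist (pos a) p)⁻¹ ^ 8 + B * (dist (pos a) p)⁻¹ ^ 14) ≤ A * S5 δ R + B * S11 δ R := by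
  rw [← Finset.sum_image (f := fun x : E3 => A * (dist x p)⁻¹ ^ 8 + B * (dist x p)⁻¹ ^ 14) (injOn_sub hinj hS)]
  unfold S5 S11
  exact sum_shellTail_le _ p hδ hR hA hB (sep_image hsep) (far_image hfar)

omit [DecidableEq ι] in
/-- Label-frame shell sum, orders `(9, 15)` (force / energy remainders). [folklore] -/
theorem sum_remTail_le_L (hinj : Set.InjOn pos ↑M) {S : Finset ι} (hS : S ⊆ M) (p : E3) {δ R A B : ℝ} (hδ : 0 < δ) (hR : δ / 2 ≤ R)
    (hA : 0 ≤ A) (hB : 0 ≤ B) (hsep : ∀ a ∈ S, ∀ b ∈ S, a ≠ b → δ ≤ dist (pos a) (pos b)) (hfar : ∀ a ∈ S, R ≤ dist (pos a) p) :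
    ∑ a ∈ S, (A * (dist (pos a) p)⁻¹ ^ 9 + B * (dist (pos a) p)⁻¹ ^ 15) ≤ A * S6 δ R + B * S12 δ R := by
  rw [← Finset.sum_image (f := fun x : E3 => A * (dist x p)⁻¹ ^ 9 + B * (dist x p)⁻¹ ^ 15) (injOn_sub hinj hS)]
  unfold S6 S12
  exact sum_remTail_le _ p hδ hR hA hB (sep_image hsep) (far_image hfar)

omit [DecidableEq ι] in
/-- Label-frame shell sum, orders `(7, 13)` (bond force / first variation). [folklore] -/
theorem sum_psiTail_le_L (hinj : Set.InjOn pos ↑M) {S : Finset ι} (hS : S ⊆ M) (p : E3) {δ R : ℝ} (hδ : 0 < δ) (hR : δ / 2 ≤ R)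
    (hsep : ∀ a ∈ S, ∀ b ∈ S, a ≠ b → δ ≤ dist (pos a) (pos b)) (hfar : ∀ a ∈ S, R ≤ dist (pos a) p) :
    ∑ a ∈ S, ((dist (pos a) p)⁻¹ ^ 7 + (dist (pos a) p)⁻¹ ^ 13) ≤ psiTail δ R := by
  rw [← Finset.sum_image (f := fun x : E3 => (dist x p)⁻¹ ^ 7 + (dist x p)⁻¹ ^ 13) (injOn_sub hinj hS)]
  unfold psiTail S4 S10
  exact sum_psiTail_le _ p hδ hR (sep_image hsep) (far_image hfar)

omit [DecidableEq ι] in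
/-- Label-frame shell sum of the linearised-force majorant `9d⁻⁸ + 15d⁻¹⁴`. [folklore] -/
theorem sum_linTail_le_L (hinj : Set.InjOn pos ↑M) {S : Finset ι} (hS : S ⊆ M) (p : E3) {δ R : ℝ} (hδ : 0 < δ) (hR : δ / 2 ≤ R)
    (hsep : ∀ a ∈ S, ∀ b ∈ S, a ≠ b → δ ≤ dist (pos a) (pos b)) (hfar : ∀ a ∈ S, R ≤ dist (pos a) p) :
    ∑ a ∈ S, (9 * (dist (pos a) p)⁻¹ ^ 8 + 15 * (dist (pos a) p)⁻¹ ^ 14) ≤ linTail δ R := by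
  unfold linTail
  exact sum_shellTail_le_L hinj hS p hδ hR (by norm_num) (by norm_num) hsep hfar

/-- `c_m − c_m^{near}` = the two FAR label sums. [folklore] -/
theorem certCoeffL_sub_near (nb : ι → Finset ι) (m : ι) :
    certCoeffL M MI pos Y m - certCoeffNearL M MI pos Y nb m
      = (if m ∈ MI then ∑ m' ∈ (M.erase m).filter (fun m' => ¬ m' ∈ nb m), ljBondForceLin (pos m - pos m') (Y m) else 0)
        - ∑ x ∈ (MI.erase m).filter (fun x => ¬ x ∈ nb m), ljBondForceLin (pos x - pos m) (Y x) := by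
  unfold certCoeffL certCoeffNearL
  rw [← Finset.sum_filter_add_sum_filter_not (M.erase m) (fun m' => m' ∈ nb m),
    ← Finset.sum_filter_add_sum_filter_not (MI.erase m) (fun x => x ∈ nb m)]
  split_ifs <;> abel

/-- Termwise bound of the far label sums by the operator-norm majorant `9d⁻⁸ + 15d⁻¹⁴`. [folklore] -/
theorem norm_certCoeffL_sub_near_le (nb : ι → Finset ι) (m : ι) :
    ‖certCoeffL M MI pos Y m - certCoeffNearL M MI pos Y nb m‖
      ≤ (if m ∈ MI then ‖Y m‖ * ∑ m' ∈ (M.erase m).filter (fun m' => ¬ m' ∈ nb m),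
            (9 * (dist (pos m') (pos m))⁻¹ ^ 8 + 15 * (dist (pos m') (pos m))⁻¹ ^ 14) else 0)
        + ∑ x ∈ (MI.erase m).filter (fun x => ¬ x ∈ nb m), (9 * (dist (pos x) (pos m))⁻¹ ^ 8 + 15 * (dist (pos x) (pos m))⁻¹ ^ 14) * ‖Y x‖ := by
  rw [certCoeffL_sub_near]
  refine (norm_sub_le _ _).trans (add_le_add ?_ ?_)
  · split_ifs with hz
    · refine (norm_sum_le _ _).trans ?_
      rw [Finset.mul_sum]
      refine Finset.sum_le_sum fun x' _ => ?_
      have h := norm_ljBondForceLin_le' (pos m - pos x') (Y m)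
      rw [← dist_eq_norm, dist_comm] at h
      linarith
    · simp
  · refine (norm_sum_le _ _).trans (Finset.sum_le_sum fun x _ => ?_)
    have h := norm_ljBondForceLin_le' (pos x - pos m) (Y x)
    rwa [← dist_eq_norm] at h

/-- ★ PAIR TAIL in the label frame: if every bond NOT on a site's near list has length `≥ L` (`L ≥ δ/2`, `δ` = separation of the placed labels),
truncating `c_m` to the near lists costs, summed over all sites, at most `2·(Σ_{x∈MI}‖Y_x‖)·TL_δ(L)`. [folklore] -/
theorem sum_norm_certCoeffL_sub_near_le (nb : ι → Finset ι) {δ L : ℝ} (hδ : 0 < δ) (hL : δ / 2 ≤ L)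
    (hsep : ∀ z ∈ M, ∀ z' ∈ M, z ≠ z' → δ ≤ dist (pos z) (pos z')) (hMI : MI ⊆ M)
    (hnb : ∀ z ∈ M, ∀ x ∈ M, x ≠ z → x ∉ nb z → L ≤ dist (pos x) (pos z)) :
    ∑ z ∈ M, ‖certCoeffL M MI pos Y z - certCoeffNearL M MI pos Y nb z‖ ≤ 2 * (∑ x ∈ MI, ‖Y x‖) * linTail δ L := by
  classical
  have hinj : Set.InjOn pos ↑M := injOn_of_sep hδ hsep
  set g : ι → ι → ℝ := fun x z => 9 * (dist (pos x) (pos z))⁻¹ ^ 8 + 15 * (dist (pos x) (pos z))⁻¹ ^ 14 with hg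
  -- the shell-sum bound around any site `p ∈ M`, over the far part of `M.erase p`
  have hshell : ∀ p ∈ M, ∑ z ∈ (M.erase p).filter (fun z => ¬ z ∈ nb p), g z p ≤ linTail δ L := by
    intro p hp
    simp only [hg]
    refine sum_linTail_le_L hinj ((Finset.filter_subset _ _).trans (Finset.erase_subset p M)) (pos p) hδ hL
      (fun u hu v hv huv => ?_) (fun u hu => ?_)
    · exact hsep u (Finset.mem_of_mem_erase (Finset.mem_filter.mp hu).1) v (Finset.mem_of_mem_erase (Finset.mem_filter.mp hv).1) huv
    · obtain ⟨hu1, hu2⟩ := Finset.mem_filter.mp hu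
      exact hnb p hp u (Finset.mem_of_mem_erase hu1) (Finset.ne_of_mem_erase hu1) hu2
  -- (1) termwise
  have h1 : ∑ z ∈ M, ‖certCoeffL M MI pos Y z - certCoeffNearL M MI pos Y nb z‖
      ≤ ∑ z ∈ M, ((if z ∈ MI then ‖Y z‖ * ∑ x' ∈ (M.erase z).filter (fun x' => ¬ x' ∈ nb z), g x' z else 0)
          + ∑ x ∈ (MI.erase z).filter (fun x => ¬ x ∈ nb z), g x z * ‖Y x‖) :=
    Finset.sum_le_sum fun z _ => norm_certCoeffL_sub_near_le nb z
  rw [Finset.sum_add_distrib] at h1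
  -- (2) the `z ∈ MI` part
  have h2 : ∑ z ∈ M, (if z ∈ MI then ‖Y z‖ * ∑ x' ∈ (M.erase z).filter (fun x' => ¬ x' ∈ nb z), g x' z else 0)
      ≤ (∑ x ∈ MI, ‖Y x‖) * linTail δ L := by
    rw [Finset.sum_ite_mem, Finset.inter_eq_right.mpr hMI, Finset.sum_mul]
    exact Finset.sum_le_sum fun z hz => mul_le_mul_of_nonneg_left (hshell z (hMI hz)) (norm_nonneg _)
  -- (3) the other part, after exchanging the sums
  have h3 : ∑ z ∈ M, ∑ x ∈ (MI.erase z).filter (fun x => ¬ x ∈ nb z), g x z * ‖Y x‖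
      = ∑ x ∈ MI, ‖Y x‖ * ∑ z ∈ (M.erase x).filter (fun z => ¬ x ∈ nb z), g x z := by
    rw [Finset.sum_comm' (t' := MI) (s' := fun x => (M.erase x).filter (fun z => ¬ x ∈ nb z)) (h := ?_)]
    · refine Finset.sum_congr rfl fun x _ => ?_
      rw [Finset.mul_sum]
      exact Finset.sum_congr rfl fun z _ => mul_comm _ _
    · intro z x
      simp only [Finset.mem_filter, Finset.mem_erase, ne_comm (a := x)]
      constructor
      · rintro ⟨hz, ⟨hxz, hx⟩, hn⟩
        exact ⟨⟨⟨hxz, hz⟩, hn⟩, hx⟩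
      · rintro ⟨⟨⟨hxz, hz⟩, hn⟩, hx⟩
        exact ⟨hz, ⟨hxz, hx⟩, hn⟩
  have h4 : ∑ x ∈ MI, ‖Y x‖ * ∑ z ∈ (M.erase x).filter (fun z => ¬ x ∈ nb z), g x z ≤ (∑ x ∈ MI, ‖Y x‖) * linTail δ L := by
    rw [Finset.sum_mul]
    refine Finset.sum_le_sum fun x hx => mul_le_mul_of_nonneg_left ?_ (norm_nonneg _)
    have eg : ∀ z, g x z = 9 * (dist (pos z) (pos x))⁻¹ ^ 8 + 15 * (dist (pos z) (pos x))⁻¹ ^ 14 := fun z => by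
      simp only [hg, dist_comm (pos x) (pos z)]
    simp only [eg]
    refine sum_linTail_le_L hinj ((Finset.filter_subset _ _).trans (Finset.erase_subset x M)) (pos x) hδ hL
      (fun u hu v hv huv => ?_) (fun u hu => ?_)
    · exact hsep u (Finset.mem_of_mem_erase (Finset.mem_filter.mp hu).1) v (Finset.mem_of_mem_erase (Finset.mem_filter.mp hv).1) huv
    · obtain ⟨hu1, hu2⟩ := Finset.mem_filter.mp hu
      have h := hnb u (Finset.mem_of_mem_erase hu1) x (hMI hx) (Finset.ne_of_mem_erase hu1).symm hu2
      rwa [dist_comm] at h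
  rw [h3] at h1
  linarith

/-- ★★ **THE NASH-COLUMN TRUNCATION IN THE LABEL FRAME.**  The K-file chooses the near-site list `MN ⊆ M∖o` and the near-bond lists `nb m`
and certifies the LABEL/window facts: far bonds are long (`x ∉ nb z ⇒ L ≤ dist`), and every site off `MN` is far from the root (`R_N ≤ ‖pos m‖`),
off the interior, and has no interior site on its near list.  Then
`Σ_{m∈M∖o} ‖ψ(‖pos m‖²)•pos m − c_m‖ ≤ Σ_{m∈MN} ‖ψ(‖pos m‖²)•pos m − c_m^{near}‖ + T0_δ(R_N) + 2·(Σ_{x∈MI}‖Y_x‖)·TL_δ(L)` (`L, R_N ≥ δ/2`). [folklore] -/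
theorem nashL_le_near_add_tails (o : ι) (nb : ι → Finset ι) (MN : Finset ι) {δ L R_N : ℝ} (hδ : 0 < δ) (hL : δ / 2 ≤ L)
    (hRN : δ / 2 ≤ R_N) (hsep : ∀ z ∈ M, ∀ z' ∈ M, z ≠ z' → δ ≤ dist (pos z) (pos z')) (hMI : MI ⊆ M)
    (hnb : ∀ z ∈ M, ∀ x ∈ M, x ≠ z → x ∉ nb z → L ≤ dist (pos x) (pos z)) (hMN : MN ⊆ M.erase o)
    (hMNc : ∀ m ∈ M.erase o, m ∉ MN → R_N ≤ ‖pos m‖ ∧ m ∉ MI ∧ ∀ x ∈ MI, x ∉ nb m) :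
    ∑ m ∈ M.erase o, ‖psiT (‖pos m‖ ^ 2) • pos m - certCoeffL M MI pos Y m‖
      ≤ ∑ m ∈ MN, ‖psiT (‖pos m‖ ^ 2) • pos m - certCoeffNearL M MI pos Y nb m‖ + psiTail δ R_N
        + 2 * (∑ x ∈ MI, ‖Y x‖) * linTail δ L := by
  classical
  have hinj : Set.InjOn pos ↑M := injOn_of_sep hδ hsep
  -- (1) termwise split `t − c = (t − c^near) − (c − c^near)`
  have h1 : ∑ m ∈ M.erase o, ‖psiT (‖pos m‖ ^ 2) • pos m - certCoeffL M MI pos Y m‖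
      ≤ ∑ m ∈ M.erase o, ‖psiT (‖pos m‖ ^ 2) • pos m - certCoeffNearL M MI pos Y nb m‖
          + ∑ m ∈ M.erase o, ‖certCoeffL M MI pos Y m - certCoeffNearL M MI pos Y nb m‖ := by
    rw [← Finset.sum_add_distrib]
    refine Finset.sum_le_sum fun m _ => ?_
    have e : psiT (‖pos m‖ ^ 2) • pos m - certCoeffL M MI pos Y m
        = (psiT (‖pos m‖ ^ 2) • pos m - certCoeffNearL M MI pos Y nb m)
            - (certCoeffL M MI pos Y m - certCoeffNearL M MI pos Y nb m) := by abel
    rw [e]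
    exact norm_sub_le _ _
  -- (2) the pair tail (over `M.erase o ⊆ M`)
  have h2 : ∑ m ∈ M.erase o, ‖certCoeffL M MI pos Y m - certCoeffNearL M MI pos Y nb m‖
      ≤ ∑ m ∈ M, ‖certCoeffL M MI pos Y m - certCoeffNearL M MI pos Y nb m‖ :=
    Finset.sum_le_sum_of_subset_of_nonneg (Finset.erase_subset o M) fun _ _ _ => norm_nonneg _
  have h3 := sum_norm_certCoeffL_sub_near_le (Y := Y) nb hδ hL hsep hMI hnb
  -- (3) near/far split of the first sum; far sites have `c^near = 0`
  rw [← Finset.sum_filter_add_sum_filter_not (M.erase o) (fun m => m ∈ MN)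
    (fun m => ‖psiT (‖pos m‖ ^ 2) • pos m - certCoeffNearL M MI pos Y nb m‖),
    Finset.filter_mem_eq_inter, Finset.inter_eq_right.mpr hMN] at h1
  have hfar0 : ∀ m ∈ (M.erase o).filter (fun m => ¬ m ∈ MN), certCoeffNearL M MI pos Y nb m = 0 := by
    intro m hm
    obtain ⟨hm1, hm2⟩ := Finset.mem_filter.mp hm
    obtain ⟨-, hmI, hnI⟩ := hMNc m hm1 hm2
    unfold certCoeffNearL
    rw [if_neg hmI, zero_sub, neg_eq_zero]
    refine Finset.sum_eq_zero fun x hx => ?_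
    exfalso
    obtain ⟨hx1, hx2⟩ := Finset.mem_filter.mp hx
    exact hnI x (Finset.mem_of_mem_erase hx1) hx2
  have h4 : ∑ m ∈ (M.erase o).filter (fun m => ¬ m ∈ MN), ‖psiT (‖pos m‖ ^ 2) • pos m - certCoeffNearL M MI pos Y nb m‖
      ≤ psiTail δ R_N := by
    have h5 : ∑ m ∈ (M.erase o).filter (fun m => ¬ m ∈ MN), ‖psiT (‖pos m‖ ^ 2) • pos m - certCoeffNearL M MI pos Y nb m‖
        ≤ ∑ m ∈ (M.erase o).filter (fun m => ¬ m ∈ MN), ((dist (pos m) (0 : E3))⁻¹ ^ 7 + (dist (pos m) (0 : E3))⁻¹ ^ 13) := by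
      refine Finset.sum_le_sum fun m hm => ?_
      rw [hfar0 m hm, sub_zero, dist_zero_right]
      exact norm_psiT_smul_le (pos m)
    refine h5.trans (sum_psiTail_le_L hinj ((Finset.filter_subset _ _).trans (Finset.erase_subset o M)) 0 hδ hRN
      (fun u hu v hv huv => ?_) (fun u hu => ?_))
    · exact hsep u (Finset.mem_of_mem_erase (Finset.mem_filter.mp hu).1) v (Finset.mem_of_mem_erase (Finset.mem_filter.mp hv).1) huv
    · obtain ⟨hu1, hu2⟩ := Finset.mem_filter.mp hu
      rw [dist_zero_right]
      exact (hMNc u hu1 hu2).1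
  linarith

/-! ### (d) the host-force pairings: near list per interior site + `T0_δ` tail; mirror-closed near lists sum to zero -/

/-- ★ HOST-FORCE PAIRING, truncated: for an interior site `m`, with any near list `nbh m` off which all template sites are `≥ L_m ≥ δ/2` away,
`⟪Y_m, Σ_{m'∈M∖m} g(pos m − pos m')⟫ ≤ ⟪Y_m, Σ_{near} g(…)⟫ + ‖Y_m‖·T0_δ(L_m)`. [folklore] -/
theorem hostForceL_le_near_add_tail (nbh : ι → Finset ι) {δ : ℝ} (hδ : 0 < δ) (hsep : ∀ z ∈ M, ∀ z' ∈ M, z ≠ z' → δ ≤ dist (pos z) (pos z'))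
    {m : ι} (hm : m ∈ M) {Lm : ℝ} (hLm : δ / 2 ≤ Lm) (hnbh : ∀ m' ∈ M, m' ≠ m → m' ∉ nbh m → Lm ≤ dist (pos m') (pos m)) :
    ⟪Y m, ∑ m' ∈ M.erase m, ljBondForce (pos m - pos m')⟫
      ≤ ⟪Y m, ∑ m' ∈ (M.erase m).filter (fun m' => m' ∈ nbh m), ljBondForce (pos m - pos m')⟫ + ‖Y m‖ * psiTail δ Lm := by
  classical
  have hinj : Set.InjOn pos ↑M := injOn_of_sep hδ hsep
  rw [← Finset.sum_filter_add_sum_filter_not (M.erase m) (fun m' => m' ∈ nbh m), inner_add_right]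
  refine add_le_add le_rfl ((real_inner_le_norm _ _).trans (mul_le_mul_of_nonneg_left ?_ (norm_nonneg _)))
  refine (norm_sum_le _ _).trans ?_
  have h1 : ∑ m' ∈ (M.erase m).filter (fun m' => ¬ m' ∈ nbh m), ‖ljBondForce (pos m - pos m')‖
      ≤ ∑ m' ∈ (M.erase m).filter (fun m' => ¬ m' ∈ nbh m), ((dist (pos m') (pos m))⁻¹ ^ 7 + (dist (pos m') (pos m))⁻¹ ^ 13) := by
    refine Finset.sum_le_sum fun m' _ => ?_
    rw [dist_comm, dist_eq_norm]
    exact norm_psiT_smul_le _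
  refine h1.trans (sum_psiTail_le_L hinj ((Finset.filter_subset _ _).trans (Finset.erase_subset m M)) (pos m) hδ hLm
    (fun u hu v hv huv => ?_) (fun u hu => ?_))
  · exact hsep u (Finset.mem_of_mem_erase (Finset.mem_filter.mp hu).1) v (Finset.mem_of_mem_erase (Finset.mem_filter.mp hv).1) huv
  · obtain ⟨hu1, hu2⟩ := Finset.mem_filter.mp hu
    have _ := hm
    exact hnbh u (Finset.mem_of_mem_erase hu1) (Finset.ne_of_mem_erase hu1) hu2

omit [DecidableEq ι] in
/-- ★ MIRROR PAIRING in the label frame: a near list closed under a label mirror `mir` that reverses the bond vector (`pos m − pos (mir m') =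
−(pos m − pos m')`, e.g. `mir m' = 2m − m'` for an affinely placed Bravais host) carries ZERO net force ((hand-1)/(210) odd pairing). [folklore] -/
theorem sum_ljBondForce_eq_zero_of_mirror (NB : Finset ι) (m : ι) (mir : ι → ι) (hmir : ∀ m' ∈ NB, mir m' ∈ NB)
    (hrev : ∀ m' ∈ NB, pos m - pos (mir m') = -(pos m - pos m')) (hinj : Set.InjOn pos ↑NB) :
    ∑ m' ∈ NB, ljBondForce (pos m - pos m') = 0 := by
  classical
  have hinj' : Set.InjOn (fun m' => pos m - pos m') ↑NB := fun u hu v hv h => hinj hu hv (sub_right_injective h)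
  rw [← Finset.sum_image (f := fun w : E3 => ljBondForce w) hinj']
  have hW : ∀ w ∈ NB.image (fun m' => pos m - pos m'), -w ∈ NB.image (fun m' => pos m - pos m') := by
    intro w hw
    obtain ⟨m', hm', rfl⟩ := Finset.mem_image.mp hw
    exact Finset.mem_image.mpr ⟨mir m', hmir m' hm', hrev m' hm'⟩
  have h := sum_ljForce_eq_zero_of_neg_mem (NB.image (fun m' => pos m - pos m')) hW
  refine (Finset.sum_congr rfl fun w _ => ?_).trans h
  unfold ljBondForce psiT
  rfl

end Trunc

end Summit.AtomisticToContinuum.Crystallization.Theorems.FrustratedLawDichotomyCellTails
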